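import Mathlib
import Literature.Analysis.FluidPDE.TimePeriodicNSLatticeSpaces
import HarnessLib

/-!
# The spatial Galerkin truncations on the space–time lattice state space

Stub `stub_spatialTruncation` (S3) of the line `work-lipschitz-cycles` for the crux
`Summit.AnomalousDissipation.AnomalousDissipation.Theses.WazewskiBlock.UniformWorkFloorTrap`
(stmt-AnomalousDissipation-10353).

On the state space `W ⊂ ℓ²(ℤ × ℤ³; ℂ³)` of
`Literature.Analysis.FluidPDE.TimePeriodicLattice.exists_space` (square-summable families
vanishing on the zero spatial modes, transversal, conjugate symmetric) the spatial truncations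
`P_N` are the Fourier multipliers with the real even symbol `d_N(n, k) = 𝟙{|k|² ≤ N²}`
(`TimePeriodicLattice.exists_diag`). They are contractions and converge strongly to the
identity: `‖P_N x − x‖² = ∑_{|k|² > N²} ‖x(n, k)‖² → 0`, the tail of a summable family
(Tannery's theorem `tendsto_tsum_of_dominated_convergence` with the summable bound `‖x(m)‖²`:
every single mode lies in `{|k|² ≤ N²}` for large `N`). [folklore]
-/

noncomputable section

-- `Summit.<Summit>.<Problem>`: single-conjunct summit, the duplicate namespace is mandated (CONVENTIONS §2).
set_option linter.dupNamespace false

namespace Summit.AnomalousDissipation.AnomalousDissipation.Theorems.UniformWorkFloorTrap.WorkLipschitzCycles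

open Filter Topology
open scoped Topology ENNReal ComplexConjugate
open Literature.Analysis.FunctionSpaces Literature.Analysis.FunctionSpaces.Torus
open Literature.Analysis.FunctionSpaces.EuclideanSpace
open Literature.Analysis.FluidPDE Literature.Analysis.FluidPDE.TimePeriodicLattice

/-- The truncation symbol `𝟙{|k|² ≤ N²}` has norm at most one. [folklore] -/
theorem norm_latticeTruncSymbol_le (N : ℕ) (m : ℤ × (Fin 3 → ℤ)) :
    ‖(if freqNormSq m.2 ≤ (N : ℝ) ^ 2 then (1 : ℂ) else 0)‖ ≤ 1 := by
  split_ifs <;> simp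

/-- The truncation symbol `𝟙{|k|² ≤ N²}` is real and even, hence conjugate symmetric. [folklore] -/
theorem latticeTruncSymbol_neg (N : ℕ) (m : ℤ × (Fin 3 → ℤ)) :
    (if freqNormSq (-m).2 ≤ (N : ℝ) ^ 2 then (1 : ℂ) else 0) =
      conj (if freqNormSq m.2 ≤ (N : ℝ) ^ 2 then (1 : ℂ) else 0) := by
  rw [Prod.snd_neg, freqNormSq_neg]
  split_ifs <;> simp

/-- Every fixed frequency eventually lies in the ball `{|k|² ≤ N²}`. [folklore] -/
theorem eventually_freqNormSq_le_sq (m : ℤ × (Fin 3 → ℤ)) :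
    ∀ᶠ N : ℕ in atTop, freqNormSq m.2 ≤ (N : ℝ) ^ 2 := by
  have h1 : Tendsto (fun N : ℕ => (N : ℝ)) atTop atTop := tendsto_natCast_atTop_atTop
  have h2 : Tendsto (fun N : ℕ => (N : ℝ) ^ 2) atTop atTop :=
    (tendsto_pow_atTop two_ne_zero).comp h1
  exact h2.eventually_ge_atTop (freqNormSq m.2)

/-- **S3 · The spatial truncations on `W`** (folklore): the Fourier multipliers `P_N = 𝟙{|k|² ≤ N²}` act on the
state space `W` of `TimePeriodicLattice.exists_space` (`exists_diag` with a real even symbol of norm `≤ 1`), are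
contractions, and converge strongly to the identity (`‖P_N x − x‖² = ∑_{|k|² > N²} ‖x(n,k)‖² → 0`, the tail of a
summable family: every finite set of modes lies in `{|k|² ≤ N²}` for large `N`). [folklore] -/
theorem stub_spatialTruncation
    {W : Submodule ℝ (lp (fun _ : ℤ × (Fin 3 → ℤ) => EuclideanSpace ℂ (Fin 3)) 2)}
    (hW : ∀ x : lp (fun _ : ℤ × (Fin 3 → ℤ) => EuclideanSpace ℂ (Fin 3)) 2, x ∈ W ↔
      (∀ n : ℤ, (x : ℤ × (Fin 3 → ℤ) → EuclideanSpace ℂ (Fin 3)) (n, 0) = 0) ∧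
      (∀ mm : ℤ × (Fin 3 → ℤ), (∑ jj : Fin 3, ((mm.2 jj : ℤ) : ℂ) *
        ((x : ℤ × (Fin 3 → ℤ) → EuclideanSpace ℂ (Fin 3)) mm) jj) = 0) ∧
      (∀ mm : ℤ × (Fin 3 → ℤ), (x : ℤ × (Fin 3 → ℤ) → EuclideanSpace ℂ (Fin 3)) (-mm) =
        conjVec ((x : ℤ × (Fin 3 → ℤ) → EuclideanSpace ℂ (Fin 3)) mm))) :
    ∃ P : ℕ → W →L[ℝ] W,
      (∀ (N : ℕ) (x : W) (m : ℤ × (Fin 3 → ℤ)),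
        (((P N x : W) : lp (fun _ : ℤ × (Fin 3 → ℤ) => EuclideanSpace ℂ (Fin 3)) 2) :
            ℤ × (Fin 3 → ℤ) → EuclideanSpace ℂ (Fin 3)) m =
          if freqNormSq m.2 ≤ (N : ℝ) ^ 2 then
            (((x : lp (fun _ : ℤ × (Fin 3 → ℤ) => EuclideanSpace ℂ (Fin 3)) 2) :
              ℤ × (Fin 3 → ℤ) → EuclideanSpace ℂ (Fin 3)) m) else 0) ∧
      (∀ N, ‖P N‖ ≤ 1) ∧ (∀ x : W, Tendsto (fun N => P N x) atTop (𝓝 x)) := by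
  -- the multipliers, one for each `N`
  choose P hP hPn using fun N : ℕ =>
    exists_diag hW (d := fun mm : ℤ × (Fin 3 → ℤ) => if freqNormSq mm.2 ≤ (N : ℝ) ^ 2 then (1 : ℂ) else 0)
      (M := 1) (norm_latticeTruncSymbol_le N) (latticeTruncSymbol_neg N)
  -- coordinates
  have hPc : ∀ (N : ℕ) (x : W) (m : ℤ × (Fin 3 → ℤ)),
      (((P N x : W) : lp (fun _ : ℤ × (Fin 3 → ℤ) => EuclideanSpace ℂ (Fin 3)) 2) :
          ℤ × (Fin 3 → ℤ) → EuclideanSpace ℂ (Fin 3)) m =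
        if freqNormSq m.2 ≤ (N : ℝ) ^ 2 then
          (((x : lp (fun _ : ℤ × (Fin 3 → ℤ) => EuclideanSpace ℂ (Fin 3)) 2) :
            ℤ × (Fin 3 → ℤ) → EuclideanSpace ℂ (Fin 3)) m) else 0 := fun N x m => by
    rw [hP N x m]
    split_ifs <;> simp
  refine ⟨P, hPc, fun N => ContinuousLinearMap.opNorm_le_bound _ zero_le_one (hPn N), fun x => ?_⟩
  -- strong convergence: `‖P N x − x‖²` is the tail sum of the summable family `‖x m‖²`
  have hx := l2_hasSum_norm_sq (x : lp (fun _ : ℤ × (Fin 3 → ℤ) => EuclideanSpace ℂ (Fin 3)) 2)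
  have hnorm : ∀ N : ℕ, ‖P N x - x‖ ^ 2 = ∑' m : ℤ × (Fin 3 → ℤ),
      (if freqNormSq m.2 ≤ (N : ℝ) ^ 2 then (0 : ℝ) else
        ‖((x : lp (fun _ : ℤ × (Fin 3 → ℤ) => EuclideanSpace ℂ (Fin 3)) 2) :
          ℤ × (Fin 3 → ℤ) → EuclideanSpace ℂ (Fin 3)) m‖ ^ 2) := fun N => by
    have h := l2_hasSum_norm_sq (((P N x - x : W)) : lp (fun _ : ℤ × (Fin 3 → ℤ) => EuclideanSpace ℂ (Fin 3)) 2)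
    rw [norm_coeW] at h
    rw [← h.tsum_eq]
    refine tsum_congr fun m => ?_
    rw [coeW_sub, Pi.sub_apply, hPc N x m]
    split_ifs <;> simp
  -- Tannery: the tail sums tend to zero
  have hlim : Tendsto (fun N : ℕ => ∑' m : ℤ × (Fin 3 → ℤ),
      (if freqNormSq m.2 ≤ (N : ℝ) ^ 2 then (0 : ℝ) else
        ‖((x : lp (fun _ : ℤ × (Fin 3 → ℤ) => EuclideanSpace ℂ (Fin 3)) 2) :
          ℤ × (Fin 3 → ℤ) → EuclideanSpace ℂ (Fin 3)) m‖ ^ 2)) atTop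
      (𝓝 (∑' _ : ℤ × (Fin 3 → ℤ), (0 : ℝ))) := by
    refine tendsto_tsum_of_dominated_convergence hx.summable (fun m => ?_)
      (Eventually.of_forall fun N m => ?_)
    · exact tendsto_const_nhds.congr' ((eventually_freqNormSq_le_sq m).mono fun N hN => by
        simp only [if_pos hN])
    · split_ifs <;> simp
  rw [tsum_zero] at hlim
  have h2 : Tendsto (fun N : ℕ => Real.sqrt (‖P N x - x‖ ^ 2)) atTop (𝓝 (Real.sqrt 0)) :=
    (hlim.congr fun N => (hnorm N).symm).sqrt
  rw [Real.sqrt_zero] at h2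
  rw [tendsto_iff_norm_sub_tendsto_zero]
  exact h2.congr fun N => Real.sqrt_sq (norm_nonneg _)

end Summit.AnomalousDissipation.AnomalousDissipation.Theorems.UniformWorkFloorTrap.WorkLipschitzCycles

end
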